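import Summits.AtomisticToContinuum.Crystallization.Theorems.BrittleRungDescentMieRungCensusBounds
import Summits.AtomisticToContinuum.Crystallization.Theorems.BrittleRungDescentMieRungSoftCap

/-!
# Route `BrittleRungDescent`, item `MieRung` (stmt-AtomisticToContinuum-10946), IX: the
# coordination census of Mie ground states — asymptotically in `q`, almost every particle of a
# ground state of `V_q` has exactly twelve neighbours in the well

Support file for the milestone `MieRung` (crystallization on the Mie `(2q, q)` ladder,
`V_q = miePotential q`, `V_q(r) = r^{-2q}/(2q) − r^{-q}/q`, in `ℝ³`).  Assembly of parts VII
(`…MieRungSoftCap`: the soft coordination cap `exists_soft_cap` from the kissing number) and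
VIII (`…MieRungCensusBounds`: the fcc trial energy `e_{V_q}(fcc) ≤ −3/q`, the site-energy bound
`𝓔ⁱ ≥ −n_i/(2q) − tail`, the counting step), with the PROVED support item `LadderGroundStates`
(existence and `(1 − 2/q)`-separation of the ground states, `q ≥ 500`) and the thermodynamic
limit of parts I–VI:

* `eventually_groundStateEnergy_div_le_ladder` — `E_{V_q}(N)/N ≤ −3/q + ε` eventually in `N`
  (fcc trial state; `q ≥ 6`);
* `natCard_near_le_twelve_of_isGroundState` — **the cap in ground states**: for `q ≥ q₀` every
  particle of every ground state of `V_q` has at most twelve others within `1 + η₀`;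
* `eventually_card_near_ne_twelve_le` — **THE CENSUS**: there is `η₀ > 0` such that for all
  `η ∈ (0, η₀]` and `δ > 0` there is `q₀` with: for every `q ≥ q₀` and every sequence of ground
  states `(x^N)` of `V_q`, eventually in `N` at most `δ N` particles `i` have soft coordination
  number `#{j ≠ i : |xᵢ − xⱼ| ≤ 1 + η} ≠ 12`.  (Energy sandwich: `2E(N) = Σ_i 𝓔ⁱ ≥ −(Σ n_i)/(2q)
  − N·O((1+η)^{-(q-6)})` against `2E(N) ≤ −6N/q + o(N)`, so `Σ_i (12 − n_i) ≤ δN` with every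
  term `≥ 0` by the cap.)  `eventually_card_not_kissed_le` restates it with the defect predicate
  of `MieSoftKissing` minus the annulus clause;
* `groundStateEnergy_ge_ladder`, `iInf_energyPerParticle_ladder_mem_Icc` — **sticky asymptotics
  of the energy**: `E_{V_q}(N) ≥ −3N/q − 8000(1+η₀)^{-(q−6)}N/q` for all `N`, and the
  thermodynamic limit `e_∞(q) = ⨅_Q e_{V_q}(Q)` lies in `[−3/q − 8000(1+η₀)^{-(q−6)}/q, −3/q]`:
  to leading order the ground-state energy of the ladder is the kissing bound `12·V_q(1)/2`.

What this is and is not.  It is the bond-counting half ("`MieBondCount`", defect DENSITY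
`→ 0` as `q → ∞`) of the crux `MieSoftKissing` (stmt-AtomisticToContinuum-10943) of the route,
proved from the plain kissing number with no computer-assisted input; it is NOT `MieSoftKissing`
(defect fraction `→ 0` as `N → ∞` at each fixed large `q`, plus the empty annulus
`(1 + η, 1.26)`), whose `o(N)` upgrade is where a `V₃`-free coercivity estimate — the open part of
the crystallization problem on the ladder — is needed.  All `[folklore]` given the inputs
(Blanc–Lewin 2015, §1.3, §2.2–§2.3).
-/

noncomputable section

open scoped BigOperators Topology
open Filter Set Metric

namespace Summit.AtomisticToContinuum.Crystallization.Theorems.MieRungCoordination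

open Literature.MathematicalPhysics.StatisticalMechanics
open Summit.AtomisticToContinuum.Crystallization.Theorems.MieRungEnergetic

/-! ### The energy upper bound on the ladder -/

/-- **`E_{V_q}(N)/N ≤ −3/q + ε` eventually** (`q ≥ 6`, `ε > 0`): the fcc configuration at unit
spacing is a periodic trial state with `e_{V_q}(fcc) ≤ −3/q` (part VIII), and `E_V(N)/N` is
eventually below every periodic energy per particle plus `ε` (part II). [folklore] -/
theorem eventually_groundStateEnergy_div_le_ladder {q : ℕ} (hq : 6 ≤ q) {ε : ℝ} (hε : 0 < ε) :
    ∀ᶠ N : ℕ in atTop, groundStateEnergy (miePotential q) 3 N / N ≤ -(3 / (q : ℝ)) + ε := by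
  have hq0 : q ≠ 0 := by omega
  have h := eventually_groundStateEnergy_div_le (V := miePotential q) (A := 1 / 6)
    (C := 31250 / (q : ℝ)) (LadderGroundStates.miePotential_zero q)
    (fun r hr => LadderGroundStates.miePotential_nonpos hq0 hr)
    (fun r hr => neg_six_le_miePotential hq hr) (by norm_num) (le_interactionEnergy_miePotential hq)
    (fccPeriodicConfiguration (a := 1) (h := Real.sqrt (2 / 3)) one_ne_zero sqrt_two_thirds_ne_zero)
    hε
  filter_upwards [h] with N hN
  exact hN.trans (by linarith [energyPerParticle_fccUnit_le hq])

/-! ### Geometric decay of the tail constant -/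

/-- For `0 ≤ c < 1`, `C ≥ 0` and `δ > 0`: `C · c^m ≤ δ` for all large `m`. [folklore] -/
theorem exists_geom_mul_le {c C δ : ℝ} (hc0 : 0 ≤ c) (hc1 : c < 1) (hC : 0 ≤ C) (hδ : 0 < δ) :
    ∃ M : ℕ, ∀ m : ℕ, M ≤ m → C * c ^ m ≤ δ := by
  obtain ⟨M, hM⟩ := exists_pow_lt_of_lt_one (show 0 < δ / (C + 1) by positivity) hc1
  refine ⟨M, fun m hm => ?_⟩
  have h1 : c ^ m ≤ c ^ M := pow_le_pow_of_le_one hc0 hc1.le hm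
  have h2 : C * c ^ m ≤ C * (δ / (C + 1)) :=
    mul_le_mul_of_nonneg_left (h1.trans hM.le) hC
  have h3 : C * (δ / (C + 1)) ≤ δ := by
    rw [mul_div_assoc', div_le_iff₀ (by positivity)]
    nlinarith
  linarith

/-! ### The soft coordination cap in ground states -/

/-- **At most twelve in the well.** There is `η₀ > 0` and `q₀` such that for every `q ≥ q₀`,
in every ground state of `V_q` every particle has at most twelve others within distance
`1 + η₀` (the ground state is `(1 − 2/q)`-separated by `LadderGroundStates`, and `2/q ≤ η₀`
brings it under the soft coordination cap of part VII). [folklore] -/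
theorem natCard_near_le_twelve_of_isGroundState :
    ∃ η₀ : ℝ, 0 < η₀ ∧ ∃ q₀ : ℕ, ∀ q : ℕ, q₀ ≤ q → ∀ {N : ℕ} (x : Fin N → EuclideanSpace ℝ (Fin 3)),
      IsGroundState (miePotential q) x → ∀ i : Fin N,
        Nat.card {j : Fin N // j ≠ i ∧ dist (x i) (x j) ≤ 1 + η₀} ≤ 12 := by
  obtain ⟨ε₁₂, hε₁₂, -, hcap⟩ := exists_soft_cap
  obtain ⟨q₁, hq₁⟩ := exists_nat_ge (2 / ε₁₂)
  refine ⟨ε₁₂, hε₁₂, max 500 q₁, fun q hq N x hx i => ?_⟩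
  have hq500 : 500 ≤ q := le_trans (le_max_left _ _) hq
  have hqq₁ : q₁ ≤ q := le_trans (le_max_right _ _) hq
  have hqpos : (0 : ℝ) < q := by exact_mod_cast (show 0 < q by omega)
  have h2q : 2 / (q : ℝ) ≤ ε₁₂ := by
    have : (2 : ℝ) / ε₁₂ ≤ q := hq₁.trans (by exact_mod_cast hqq₁)
    rw [div_le_iff₀ hε₁₂] at this
    rw [div_le_iff₀ hqpos]
    linarith
  refine hcap x (fun k l hkl => ?_) i
  have := LadderGroundStates.le_dist_of_isGroundState_miePotential hq500 hx hkl
  linarith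

/-! ### The census -/

/-- **The coordination census of Mie ground states.** There is `η₀ > 0` such that for every
tolerance `η ∈ (0, η₀]` and every `δ > 0` there is `q₀` with: for every `q ≥ q₀` and every
sequence `(x^N)_N` of ground states of `V_q = miePotential q` in `ℝ³`, eventually in `N` at
most `δ N` particles `i` have soft coordination number
`#{j ≠ i : |xᵢ − xⱼ| ≤ 1 + η} ≠ 12` — asymptotically in `q`, all but a fraction `δ` of the
particles of every large ground state have EXACTLY twelve neighbours in the well.  Proof: the
energy sandwich `−(Σ n_i)/(2q) − N·32000·(1+η)^{-(q−6)}/(2q) ≤ 2E(N) ≤ 2N(−3/q + δ/(8q))`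
(parts VIII and II, separation `1 − 2/q ≥ 1/2`) gives `Σ_i n_i ≥ (12 − δ)N` once
`32000 (1+η)^{-(q−6)} ≤ δ/2`, and `n_i ≤ 12` for all `i` (part VII). [folklore] -/
theorem eventually_card_near_ne_twelve_le :
    ∃ η₀ : ℝ, 0 < η₀ ∧ ∀ η : ℝ, 0 < η → η ≤ η₀ → ∀ δ : ℝ, 0 < δ → ∃ q₀ : ℕ, ∀ q : ℕ, q₀ ≤ q →
      ∀ x : (N : ℕ) → (Fin N → EuclideanSpace ℝ (Fin 3)),
        (∀ N, IsGroundState (miePotential q) (x N)) →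
          ∀ᶠ N : ℕ in atTop,
            (Nat.card {i : Fin N //
                Nat.card {j : Fin N // j ≠ i ∧ dist (x N i) (x N j) ≤ 1 + η} ≠ 12} : ℝ) ≤
              δ * N := by
  classical
  obtain ⟨ε₁₂, hε₁₂, -, hcap⟩ := exists_soft_cap
  refine ⟨ε₁₂, hε₁₂, fun η hη hηε δ hδ => ?_⟩
  -- thresholds in `q`: the tail `32000 (1+η)^{-(q-6)} ≤ δ/2`, the separation `2/q ≤ ε₁₂`, `q ≥ 500`
  have hc0 : 0 ≤ (1 + η)⁻¹ := inv_nonneg.2 (by linarith)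
  have hc1 : (1 + η)⁻¹ < 1 := inv_lt_one_of_one_lt₀ (by linarith)
  obtain ⟨M, hM⟩ := exists_geom_mul_le hc0 hc1 (show (0 : ℝ) ≤ 32000 by norm_num) (half_pos hδ)
  obtain ⟨q₁, hq₁⟩ := exists_nat_ge (2 / ε₁₂)
  refine ⟨max (max 500 (M + 6)) q₁, fun q hq x hx => ?_⟩
  have hq500 : 500 ≤ q := le_trans (le_trans (le_max_left _ _) (le_max_left _ _)) hq
  have hqM6 : M + 6 ≤ q := le_trans (le_trans (le_max_right _ _) (le_max_left _ _)) hq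
  have hqq₁ : q₁ ≤ q := le_trans (le_max_right _ _) hq
  have hqM : M ≤ q - 6 := by omega
  have hq6 : 6 ≤ q := by omega
  have hqpos : (0 : ℝ) < q := by exact_mod_cast (show 0 < q by omega)
  have hq500r : (500 : ℝ) ≤ q := by exact_mod_cast hq500
  -- the separation radius `r = 1 − 2/q`
  set r : ℝ := 1 - 2 / (q : ℝ) with hr_def
  have h2q : 2 / (q : ℝ) ≤ ε₁₂ := by
    have : (2 : ℝ) / ε₁₂ ≤ q := hq₁.trans (by exact_mod_cast hqq₁)
    rw [div_le_iff₀ hε₁₂] at this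
    rw [div_le_iff₀ hqpos]
    linarith
  have h2q' : 2 / (q : ℝ) ≤ 1 / 2 := by
    rw [div_le_iff₀ hqpos]
    linarith
  have hr_half : (1 : ℝ) / 2 ≤ r := by rw [hr_def]; linarith
  have hr0 : 0 < r := by linarith
  have hrε : 1 - ε₁₂ ≤ r := by rw [hr_def]; linarith
  have hr6 : r⁻¹ ^ 6 ≤ 64 := by
    have h2 : r⁻¹ ≤ 2 :=
      calc r⁻¹ ≤ (1 / 2 : ℝ)⁻¹ := inv_anti₀ (by norm_num) hr_half
        _ = 2 := by norm_num
    calc r⁻¹ ^ 6 ≤ (2 : ℝ) ^ 6 := pow_le_pow_left₀ (inv_nonneg.2 hr0.le) h2 6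
      _ = 64 := by norm_num
  -- the tail constant
  have htail : 2 * (q : ℝ) * (250 * r⁻¹ ^ 6 / (q : ℝ) * (1 + η)⁻¹ ^ (q - 6)) ≤ δ / 2 := by
    have hcq : 0 ≤ (1 + η)⁻¹ ^ (q - 6) := pow_nonneg hc0 _
    have h1 : 2 * (q : ℝ) * (250 * r⁻¹ ^ 6 / (q : ℝ) * (1 + η)⁻¹ ^ (q - 6)) =
        500 * r⁻¹ ^ 6 * (1 + η)⁻¹ ^ (q - 6) := by
      field_simp
      ring
    rw [h1]
    calc 500 * r⁻¹ ^ 6 * (1 + η)⁻¹ ^ (q - 6) ≤ 500 * 64 * (1 + η)⁻¹ ^ (q - 6) :=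
          mul_le_mul_of_nonneg_right (by linarith) hcq
      _ = 32000 * (1 + η)⁻¹ ^ (q - 6) := by norm_num
      _ ≤ δ / 2 := hM (q - 6) hqM
  -- along the sequence of ground states, eventually in `N`
  have hεq : 0 < δ / (8 * (q : ℝ)) := by positivity
  filter_upwards [eventually_groundStateEnergy_div_le_ladder hq6 hεq, eventually_gt_atTop 0]
    with N hEN hN0
  have hy := hx N
  have hNpos : (0 : ℝ) < N := by exact_mod_cast hN0
  have hsep : ∀ k l : Fin N, k ≠ l → r ≤ dist (x N k) (x N l) := fun k l hkl =>
    LadderGroundStates.le_dist_of_isGroundState_miePotential hq500 hy hkl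
  -- the cap: `n_i(η) ≤ n_i(ε₁₂) ≤ 12`
  have hcap' : ∀ i : Fin N,
      Nat.card {j : Fin N // j ≠ i ∧ dist (x N i) (x N j) ≤ 1 + η} ≤ 12 := fun i =>
    (natCard_near_mono (x N) hηε i).trans (hcap (x N) (fun k l hkl => hrε.trans (hsep k l hkl)) i)
  -- lower bound on `2𝓔`
  have hlow := two_mul_interactionEnergy_ge_sum_nearCount hq6 hr0 hsep
    (show 0 < 1 + η by linarith) (x := x N)
  -- upper bound: `𝓔(x^N) = E(N) ≤ N(−3/q + δ/(8q))`
  have hup : interactionEnergy (miePotential q) (x N) ≤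
      (N : ℝ) * (-(3 / (q : ℝ)) + δ / (8 * (q : ℝ))) := by
    rw [hy.2]
    rw [div_le_iff₀ hNpos] at hEN
    linarith
  -- combine to `Σ n_i ≥ 12N − δN`
  set T : ℝ := 250 * r⁻¹ ^ 6 / (q : ℝ) * (1 + η)⁻¹ ^ (q - 6) with hT_def
  set S : ℝ := ∑ i : Fin N, (Nat.card {j : Fin N // j ≠ i ∧ dist (x N i) (x N j) ≤ 1 + η} : ℝ)
    with hS_def
  have hsum : 12 * (N : ℝ) - δ * N ≤ S := by
    have h1 : -(S / (2 * (q : ℝ))) - (N : ℝ) * T ≤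
        2 * ((N : ℝ) * (-(3 / (q : ℝ)) + δ / (8 * (q : ℝ)))) := hlow.trans (by linarith)
    have h2 := mul_le_mul_of_nonneg_left h1 (show (0 : ℝ) ≤ 2 * q by positivity)
    have e1 : 2 * (q : ℝ) * (-(S / (2 * (q : ℝ))) - (N : ℝ) * T) =
        -S - (N : ℝ) * (2 * (q : ℝ) * T) := by
      field_simp
    have e2 : 2 * (q : ℝ) * (2 * ((N : ℝ) * (-(3 / (q : ℝ)) + δ / (8 * (q : ℝ))))) =
        -(12 * (N : ℝ)) + δ / 2 * N := by
      field_simp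
      ring
    rw [e1, e2] at h2
    have h3 : (N : ℝ) * (2 * (q : ℝ) * T) ≤ (N : ℝ) * (δ / 2) :=
      mul_le_mul_of_nonneg_left htail hNpos.le
    linarith
  -- count
  have hcount := card_ne_twelve_le hcap' (B := δ * N) (by rw [hS_def] at hsum; linarith)
  have hconv : (Nat.card {i : Fin N //
      Nat.card {j : Fin N // j ≠ i ∧ dist (x N i) (x N j) ≤ 1 + η} ≠ 12} : ℝ) =
      ((Finset.univ.filter fun i : Fin N =>
        Nat.card {j : Fin N // j ≠ i ∧ dist (x N i) (x N j) ≤ 1 + η} ≠ 12).card : ℝ) := by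
    rw [Nat.card_eq_fintype_card, Fintype.card_subtype]
  rw [hconv]
  convert hcount using 3

/-! ### Sticky asymptotics of the ground-state energy on the ladder -/

/-- **The ground-state energy is the kissing bound up to an exponentially small error (lower
bound, all `N`).** There are `η₀ > 0` and `q₀` such that for every `q ≥ q₀` and every `N`,
`E_{V_q}(N) ≥ −3N/q − 8000·(1+η₀)^{-(q−6)}·N/q`: in a ground state (which exists) every particle
has at most twelve others in the well (each worth at least `−1/(2q)`), and the rest of its site
energy is the tail `≥ −(250·2⁶/q)(1+η₀)^{-(q−6)}` (separation `1 − 2/q ≥ 1/2`). [folklore] -/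
theorem groundStateEnergy_ge_ladder :
    ∃ η₀ : ℝ, 0 < η₀ ∧ ∃ q₀ : ℕ, ∀ q : ℕ, q₀ ≤ q → ∀ N : ℕ,
      -(3 / (q : ℝ)) * N - 8000 * (1 + η₀)⁻¹ ^ (q - 6) / (q : ℝ) * N ≤
        groundStateEnergy (miePotential q) 3 N := by
  classical
  obtain ⟨ε₁₂, hε₁₂, -, hcap⟩ := exists_soft_cap
  obtain ⟨q₁, hq₁⟩ := exists_nat_ge (2 / ε₁₂)
  refine ⟨ε₁₂, hε₁₂, max 500 q₁, fun q hq N => ?_⟩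
  have hq500 : 500 ≤ q := le_trans (le_max_left _ _) hq
  have hqq₁ : q₁ ≤ q := le_trans (le_max_right _ _) hq
  have hq6 : 6 ≤ q := by omega
  have hqpos : (0 : ℝ) < q := by exact_mod_cast (show 0 < q by omega)
  have hq500r : (500 : ℝ) ≤ q := by exact_mod_cast hq500
  obtain ⟨x, hx⟩ := LadderGroundStates.exists_isGroundState_miePotential (show 1 ≤ q by omega) N
  set r : ℝ := 1 - 2 / (q : ℝ) with hr_def
  have h2q : 2 / (q : ℝ) ≤ ε₁₂ := by
    have : (2 : ℝ) / ε₁₂ ≤ q := hq₁.trans (by exact_mod_cast hqq₁)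
    rw [div_le_iff₀ hε₁₂] at this
    rw [div_le_iff₀ hqpos]
    linarith
  have h2q' : 2 / (q : ℝ) ≤ 1 / 2 := by
    rw [div_le_iff₀ hqpos]
    linarith
  have hr0 : 0 < r := by rw [hr_def]; linarith
  have hrε : 1 - ε₁₂ ≤ r := by rw [hr_def]; linarith
  have hr6 : r⁻¹ ^ 6 ≤ 64 := by
    have hr_half : (1 : ℝ) / 2 ≤ r := by rw [hr_def]; linarith
    have h2 : r⁻¹ ≤ 2 :=
      calc r⁻¹ ≤ (1 / 2 : ℝ)⁻¹ := inv_anti₀ (by norm_num) hr_half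
        _ = 2 := by norm_num
    calc r⁻¹ ^ 6 ≤ (2 : ℝ) ^ 6 := pow_le_pow_left₀ (inv_nonneg.2 hr0.le) h2 6
      _ = 64 := by norm_num
  have hsep : ∀ k l : Fin N, k ≠ l → r ≤ dist (x k) (x l) := fun k l hkl =>
    LadderGroundStates.le_dist_of_isGroundState_miePotential hq500 hx hkl
  have hcap' : ∀ i : Fin N,
      Nat.card {j : Fin N // j ≠ i ∧ dist (x i) (x j) ≤ 1 + ε₁₂} ≤ 12 := fun i =>
    hcap x (fun k l hkl => hrε.trans (hsep k l hkl)) i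
  have hlow := two_mul_interactionEnergy_ge_sum_nearCount hq6 hr0 hsep
    (show 0 < 1 + ε₁₂ by linarith) (x := x)
  -- `Σ n_i ≤ 12 N`
  have hS : (∑ i : Fin N, (Nat.card {j : Fin N // j ≠ i ∧ dist (x i) (x j) ≤ 1 + ε₁₂} : ℝ)) ≤
      12 * N := by
    calc (∑ i : Fin N, (Nat.card {j : Fin N // j ≠ i ∧ dist (x i) (x j) ≤ 1 + ε₁₂} : ℝ))
        ≤ ∑ _i : Fin N, (12 : ℝ) := Finset.sum_le_sum fun i _ => by exact_mod_cast hcap' i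
      _ = 12 * N := by
          rw [Finset.sum_const, Finset.card_univ, Fintype.card_fin, nsmul_eq_mul, mul_comm]
  -- the tail constant: `250 r⁻⁶ c^(q-6)/q ≤ 16000 c^(q-6)/q`
  have hc0 : 0 ≤ (1 + ε₁₂)⁻¹ ^ (q - 6) := pow_nonneg (inv_nonneg.2 (by linarith)) _
  have hT : 250 * r⁻¹ ^ 6 / (q : ℝ) * (1 + ε₁₂)⁻¹ ^ (q - 6) ≤
      16000 * (1 + ε₁₂)⁻¹ ^ (q - 6) / (q : ℝ) := by
    rw [div_mul_eq_mul_div, div_le_div_iff_of_pos_right hqpos]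
    nlinarith
  have hN0 : (0 : ℝ) ≤ N := Nat.cast_nonneg N
  rw [← hx.2]
  -- `2𝓔 ≥ −12N/(2q) − N·16000 c^(q-6)/q`
  have h1 : -((12 * (N : ℝ)) / (2 * (q : ℝ))) - (N : ℝ) * (16000 * (1 + ε₁₂)⁻¹ ^ (q - 6) / (q : ℝ))
      ≤ 2 * interactionEnergy (miePotential q) x := by
    refine le_trans ?_ hlow
    have ha : -((12 * (N : ℝ)) / (2 * (q : ℝ))) ≤
        -((∑ i : Fin N, (Nat.card {j : Fin N // j ≠ i ∧ dist (x i) (x j) ≤ 1 + ε₁₂} : ℝ)) /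
          (2 * (q : ℝ))) := by
      rw [neg_le_neg_iff]
      exact div_le_div_of_nonneg_right hS (by positivity)
    have hb : (N : ℝ) * (250 * r⁻¹ ^ 6 / (q : ℝ) * (1 + ε₁₂)⁻¹ ^ (q - 6)) ≤
        (N : ℝ) * (16000 * (1 + ε₁₂)⁻¹ ^ (q - 6) / (q : ℝ)) :=
      mul_le_mul_of_nonneg_left hT hN0
    linarith
  have e1 : -((12 * (N : ℝ)) / (2 * (q : ℝ))) = 2 * (-(3 / (q : ℝ)) * N) := by
    field_simp
    ring
  have e2 : (N : ℝ) * (16000 * (1 + ε₁₂)⁻¹ ^ (q - 6) / (q : ℝ)) =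
      2 * (8000 * (1 + ε₁₂)⁻¹ ^ (q - 6) / (q : ℝ) * N) := by
    field_simp
    ring
  rw [e1, e2] at h1
  linarith

/-- **Sticky asymptotics of the thermodynamic limit**: with the same `η₀`, `q₀`, for every
`q ≥ q₀` the ground-state energy per particle `e_∞(q) = lim_N E_{V_q}(N)/N = ⨅_Q e_{V_q}(Q)`
(parts II, VI) satisfies `−3/q − 8000(1+η₀)^{-(q−6)}/q ≤ e_∞(q) ≤ −3/q` — to leading order in
`q` the ground-state energy of the Mie ladder in `ℝ³` is the kissing bound `6 · V_q(1) / 2`.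
[folklore] -/
theorem iInf_energyPerParticle_ladder_mem_Icc :
    ∃ η₀ : ℝ, 0 < η₀ ∧ ∃ q₀ : ℕ, ∀ q : ℕ, q₀ ≤ q →
      (⨅ Q : PeriodicConfiguration 3, Q.energyPerParticle (miePotential q)) ∈
        Set.Icc (-(3 / (q : ℝ)) - 8000 * (1 + η₀)⁻¹ ^ (q - 6) / (q : ℝ)) (-(3 / (q : ℝ))) := by
  obtain ⟨η₀, hη₀, q₀, hq₀⟩ := groundStateEnergy_ge_ladder
  refine ⟨η₀, hη₀, max q₀ 6, fun q hq => ?_⟩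
  have hqq₀ : q₀ ≤ q := le_trans (le_max_left _ _) hq
  have hq6 : 6 ≤ q := le_trans (le_max_right _ _) hq
  have hq0 : q ≠ 0 := by omega
  have hlim := tendsto_groundStateEnergy_div (V := miePotential q) (A := 1 / 6)
    (C := 31250 / (q : ℝ)) (LadderGroundStates.miePotential_zero q)
    (fun r hr => LadderGroundStates.miePotential_nonpos hq0 hr)
    (fun r hr => neg_six_le_miePotential hq6 hr) (by norm_num)
    (le_interactionEnergy_miePotential hq6)
  refine ⟨?_, ?_⟩
  · -- lower bound: pass to the limit in `E(N)/N ≥ −3/q − K`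
    refine ge_of_tendsto hlim (Filter.eventually_atTop.2 ⟨1, fun N hN => ?_⟩)
    have hNpos : (0 : ℝ) < N := by exact_mod_cast hN
    rw [le_div_iff₀ hNpos]
    have := hq₀ q hqq₀ N
    linarith
  · -- upper bound: the fcc trial state
    exact (iInf_le_energyPerParticle
      (fccPeriodicConfiguration (a := 1) (h := Real.sqrt (2 / 3)) one_ne_zero
        sqrt_two_thirds_ne_zero) (LadderGroundStates.miePotential_zero q)
      (fun r hr => LadderGroundStates.miePotential_nonpos hq0 hr)
      (fun r hr => neg_six_le_miePotential hq6 hr) (by norm_num)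
      (le_interactionEnergy_miePotential hq6)).trans (energyPerParticle_fccUnit_le hq6)

/-- **The census in the vocabulary of the crux `MieSoftKissing`** (its defect predicate with the
annulus condition `|xᵢ − xⱼ| ∉ (1 + η, 1.26)` removed): with `η₀` as above, for `η ∈ (0, η₀]`,
`δ > 0` and `q ≥ q₀(η, δ)`, along every sequence of ground states of `V_q`, eventually at most
`δ N` particles fail to be [at distance `≥ 1 − η` from all others, with exactly twelve others
within `1 + η`] — the first clause never fails once `2/q ≤ η` (separation `1 − 2/q`).
[folklore] -/
theorem eventually_card_not_kissed_le :
    ∃ η₀ : ℝ, 0 < η₀ ∧ ∀ η : ℝ, 0 < η → η ≤ η₀ → ∀ δ : ℝ, 0 < δ → ∃ q₀ : ℕ, ∀ q : ℕ, q₀ ≤ q →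
      ∀ x : (N : ℕ) → (Fin N → EuclideanSpace ℝ (Fin 3)),
        (∀ N, IsGroundState (miePotential q) (x N)) →
          ∀ᶠ N : ℕ in atTop,
            (Nat.card {i : Fin N // ¬ ((∀ j : Fin N, j ≠ i → 1 - η ≤ dist (x N i) (x N j)) ∧
                Nat.card {j : Fin N // j ≠ i ∧ dist (x N i) (x N j) ≤ 1 + η} = 12)} : ℝ) ≤
              δ * N := by
  obtain ⟨η₀, hη₀, hcensus⟩ := eventually_card_near_ne_twelve_le
  refine ⟨η₀, hη₀, fun η hη hηη₀ δ hδ => ?_⟩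
  obtain ⟨q₀, hq₀⟩ := hcensus η hη hηη₀ δ hδ
  obtain ⟨q₁, hq₁⟩ := exists_nat_ge (2 / η)
  refine ⟨max (max q₀ 500) q₁, fun q hq x hx => ?_⟩
  have hqq₀ : q₀ ≤ q := le_trans (le_trans (le_max_left _ _) (le_max_left _ _)) hq
  have hq500 : 500 ≤ q := le_trans (le_trans (le_max_right _ _) (le_max_left _ _)) hq
  have hqq₁ : q₁ ≤ q := le_trans (le_max_right _ _) hq
  have hqpos : (0 : ℝ) < q := by exact_mod_cast (show 0 < q by omega)
  have h2q : 2 / (q : ℝ) ≤ η := by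
    have : (2 : ℝ) / η ≤ q := hq₁.trans (by exact_mod_cast hqq₁)
    rw [div_le_iff₀ hη] at this
    rw [div_le_iff₀ hqpos]
    linarith
  filter_upwards [hq₀ q hqq₀ x hx] with N hN
  -- the separation clause holds for every particle, so the two defect sets coincide
  have hsep : ∀ i j : Fin N, j ≠ i → 1 - η ≤ dist (x N i) (x N j) := fun i j hji => by
    have := LadderGroundStates.le_dist_of_isGroundState_miePotential hq500 (hx N) hji.symm
    linarith
  have hcard : Nat.card {i : Fin N // ¬ ((∀ j : Fin N, j ≠ i → 1 - η ≤ dist (x N i) (x N j)) ∧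
      Nat.card {j : Fin N // j ≠ i ∧ dist (x N i) (x N j) ≤ 1 + η} = 12)} =
      Nat.card {i : Fin N //
        Nat.card {j : Fin N // j ≠ i ∧ dist (x N i) (x N j) ≤ 1 + η} ≠ 12} :=
    Nat.card_congr (Equiv.subtypeEquivRight fun i =>
      ⟨fun h h12 => h ⟨hsep i, h12⟩, fun h h' => h h'.2⟩)
  rw [hcard]
  exact hN

end Summit.AtomisticToContinuum.Crystallization.Theorems.MieRungCoordination

end
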